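import Mathlib

/-!
# Route BarrierLever — Chow witnesses for partition minors (item 20172, CPM): determinant algebra of
# the DOUBLE STEP (two row coordinates against two column coordinates)

Helper file (`--supports stmt-ValiantsHypothesis-20172`; cell valiant-natproofs, rung V4, 𝒟-side of
door (c); seat val-np-p4 gen 13).  Closes NO item; Mathlib only — pure matrix algebra, consumed by
`…ChowDoubleStep` (the `k = 2` tensor blow-down of the seat memo HOME/val-np-p4/g13).

`exists_det_doubleEdge_ne_zero` — the `k = 2` analogue of `exists_det_edge_ne_zero`
(`…ChowEdgeStep`).  Let `F` be a square matrix over `ℂ` indexed by `Fin (n + 2)` with three equal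
rows `i₀, v₁, v₂` (`v₂ = v₁.succAbove v₂''`) and two pairs of equal columns `j₁ = j₀`,
`j₂ = j₀'` (`j₂ = j₁.succAbove j₂''`; `j₀ = j₀'` allowed).  Row statuses `P₁, P₂` and column statuses
`Q₁, Q₂` are given with `v₁` differing from `i₀` exactly in `P₁` and `v₂` exactly in `P₂` (the
«star-like» pattern of two special rows).  Consider the two-fold deformation
`M(t) i j = t^{[P₁ i ∧ Q₁ j]} · t^{[P₂ i ∧ Q₂ j]} · F i j`.  If `F i₀ j₀ ≠ 0`, `F i₀ j₀' ≠ 0`, the minor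
of `F` off the rows `v₁, v₂` and the columns `j₁, j₂` is nonsingular, and the `2 × 2` integer matrix of
status differences `δ_{pe} = [Q_p j_e] − [Q_p j_{rep(e)}]` is nonsingular, then `det M(t) ≠ 0` for
some `t`.  Proof: over `ℂ[X]`, subtracting row `i₀` from rows `v₁` and `v₂` factors `(X − 1)²`
(`det_doubleEdgeMatrix_eq`); at `X = 1` the remaining determinant is, after subtracting column
`j₀` from `j₁` and `j₀'` from `j₂` and passing to block form (`exists_equivPairCompl`,
`Matrix.det_fromBlocks_zero₂₁`), `± F i₀ j₀ · F i₀ j₀' · det δ · det(minor) ≠ 0`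
(`det_doubleMasked_ne_zero`); a nonzero polynomial has a non-root off `1`.

WHAT THIS IS NOT: no polynomial, layout or witness appears here; nothing on items 20172 / 20195 /
19717, on crux stmt-ValiantsHypothesis-14610, or on `VP` versus `VNP`.
-/

set_option linter.dupNamespace false

namespace Summit.ValiantsHypothesis.ValiantsHypothesis.Theorems.BarrierLever.ChowFactor

open Finset

noncomputable section

/-! ## 1. Two marked indices and their complement -/

/-- **An equivalence `Fin 2 ⊕ Fin n ≃ Fin (n + 2)`** sending `inl 0 ↦ v₁`, `inl 1 ↦ v₁.succAbove v₂''`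
and `inr k ↦ v₁.succAbove (v₂''.succAbove k)`. -/
theorem exists_equivPairCompl {n : ℕ} (v₁ : Fin (n + 2)) (v₂'' : Fin (n + 1)) :
    ∃ e : Fin 2 ⊕ Fin n ≃ Fin (n + 2), e (Sum.inl 0) = v₁ ∧ e (Sum.inl 1) = v₁.succAbove v₂'' ∧
      ∀ k, e (Sum.inr k) = v₁.succAbove (v₂''.succAbove k) := by
  classical
  set f : Fin 2 ⊕ Fin n → Fin (n + 2) :=
    Sum.elim (fun x => if x = 0 then v₁ else v₁.succAbove v₂'')
      (fun k => v₁.succAbove (v₂''.succAbove k)) with hf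
  have hinj : Function.Injective f := by
    rintro (x | k) (y | l) hxy
    · simp only [hf, Sum.elim_inl] at hxy
      by_cases hx : x = 0 <;> by_cases hy : y = 0
      · rw [hx, hy]
      · rw [if_pos hx, if_neg hy] at hxy; exact absurd hxy.symm (Fin.succAbove_ne v₁ v₂'')
      · rw [if_neg hx, if_pos hy] at hxy; exact absurd hxy (Fin.succAbove_ne v₁ v₂'')
      · have hx1 : x = 1 := by omega
        have hy1 : y = 1 := by omega
        rw [hx1, hy1]
    · simp only [hf, Sum.elim_inl, Sum.elim_inr] at hxy
      by_cases hx : x = 0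
      · rw [if_pos hx] at hxy; exact absurd hxy.symm (Fin.succAbove_ne v₁ _)
      · rw [if_neg hx] at hxy
        exact absurd (Fin.succAbove_right_injective hxy).symm (Fin.succAbove_ne v₂'' l)
    · simp only [hf, Sum.elim_inl, Sum.elim_inr] at hxy
      by_cases hy : y = 0
      · rw [if_pos hy] at hxy; exact absurd hxy (Fin.succAbove_ne v₁ _)
      · rw [if_neg hy] at hxy
        exact absurd (Fin.succAbove_right_injective hxy) (Fin.succAbove_ne v₂'' k)
    · simp only [hf, Sum.elim_inr] at hxy
      rw [Fin.succAbove_right_injective (Fin.succAbove_right_injective hxy)]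
  have hbij : Function.Bijective f := by
    rw [Fintype.bijective_iff_injective_and_card]
    exact ⟨hinj, by simp [add_comm]⟩
  refine ⟨Equiv.ofBijective f hbij, ?_, ?_, fun k => ?_⟩
  · simp [hf]
  · simp [hf]
  · simp [hf]

/-! ## 2. The doubly-masked matrix at `X = 1` -/

/-- **Two masked copies of a row against two doubled columns.**  Replace the rows `v₁`, `v₂` of `F`
(`v₂ = v₁.succAbove v₂''`) by `Q₁`- resp. `Q₂`-masked signed copies of row `i₀`; if the columns
`j₁ = j₀` and `j₂ = j₀'` of `F` coincide (`j₂ = j₁.succAbove j₂''`), the entries `F i₀ j₀`, `F i₀ j₀'`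
are nonzero, the status-difference determinant is nonzero and the minor off rows `v₁, v₂` and
columns `j₁, j₂` is nonsingular, then the masked matrix is nonsingular. -/
theorem det_doubleMasked_ne_zero {n : ℕ} (F : Matrix (Fin (n + 2)) (Fin (n + 2)) ℂ)
    (Q₁ Q₂ : Fin (n + 2) → Prop) [DecidablePred Q₁] [DecidablePred Q₂] (s₁ s₂ : ℂ)
    (hs₁ : s₁ ≠ 0) (hs₂ : s₂ ≠ 0) (i₀ v₁ : Fin (n + 2)) (v₂'' : Fin (n + 1))
    (j₀ j₀' j₁ : Fin (n + 2)) (j₂'' : Fin (n + 1))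
    (hj₀ : j₀ ≠ j₁) (hj₀' : j₀' ≠ j₁) (hj₀'₂ : j₀' ≠ j₁.succAbove j₂'')
    (hcol₁ : ∀ i, F i j₁ = F i j₀) (hcol₂ : ∀ i, F i (j₁.succAbove j₂'') = F i j₀')
    (hδ : ((if Q₁ j₁ then (1 : ℂ) else 0) - (if Q₁ j₀ then 1 else 0)) *
        ((if Q₂ (j₁.succAbove j₂'') then (1 : ℂ) else 0) - (if Q₂ j₀' then 1 else 0)) ≠
      ((if Q₁ (j₁.succAbove j₂'') then (1 : ℂ) else 0) - (if Q₁ j₀' then 1 else 0)) *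
        ((if Q₂ j₁ then (1 : ℂ) else 0) - (if Q₂ j₀ then 1 else 0)))
    (hent₁ : F i₀ j₀ ≠ 0) (hent₂ : F i₀ j₀' ≠ 0)
    (hminor : (F.submatrix (fun k => v₁.succAbove (v₂''.succAbove k))
      (fun k => j₁.succAbove (j₂''.succAbove k))).det ≠ 0) :
    ((F.updateRow v₁ (fun j => (if Q₁ j then (1 : ℂ) else 0) * (s₁ * F i₀ j))).updateRow
      (v₁.succAbove v₂'') (fun j => (if Q₂ j then (1 : ℂ) else 0) * (s₂ * F i₀ j))).det ≠ 0 := by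
  classical
  set v₂ := v₁.succAbove v₂'' with hv₂
  set j₂ := j₁.succAbove j₂'' with hj₂
  have hv₁₂ : v₂ ≠ v₁ := Fin.succAbove_ne v₁ v₂''
  have hj₁₂ : j₂ ≠ j₁ := Fin.succAbove_ne j₁ j₂''
  set N : Matrix (Fin (n + 2)) (Fin (n + 2)) ℂ :=
    (F.updateRow v₁ (fun j => (if Q₁ j then (1 : ℂ) else 0) * (s₁ * F i₀ j))).updateRow v₂
      (fun j => (if Q₂ j then (1 : ℂ) else 0) * (s₂ * F i₀ j)) with hN
  -- entries of `N`
  have hNrest : ∀ i j, i ≠ v₁ → i ≠ v₂ → N i j = F i j := by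
    intro i j h1 h2
    rw [hN, Matrix.updateRow_ne h2, Matrix.updateRow_ne h1]
  have hNv₁ : ∀ j, N v₁ j = (if Q₁ j then (1 : ℂ) else 0) * (s₁ * F i₀ j) := by
    intro j
    rw [hN, Matrix.updateRow_ne hv₁₂.symm, Matrix.updateRow_self]
  have hNv₂ : ∀ j, N v₂ j = (if Q₂ j then (1 : ℂ) else 0) * (s₂ * F i₀ j) := by
    intro j
    rw [hN, Matrix.updateRow_self]
  -- the two column operations
  set N₁ : Matrix (Fin (n + 2)) (Fin (n + 2)) ℂ :=
    N.updateCol j₁ (fun i => N i j₁ + (-1 : ℂ) • N i j₀) with hN₁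
  set N₂ : Matrix (Fin (n + 2)) (Fin (n + 2)) ℂ :=
    N₁.updateCol j₂ (fun i => N₁ i j₂ + (-1 : ℂ) • N₁ i j₀') with hN₂
  have hdet₁ : N₁.det = N.det := Matrix.det_updateCol_add_smul_self N hj₀.symm (-1)
  have hdet₂ : N₂.det = N₁.det := Matrix.det_updateCol_add_smul_self N₁ hj₀'₂.symm (-1)
  -- entries of `N₂`
  have hN₁_of_ne : ∀ i j, j ≠ j₁ → N₁ i j = N i j := fun i j hj => by
    rw [hN₁, Matrix.updateCol_ne hj]
  have hN₂_of_ne : ∀ i j, j ≠ j₁ → j ≠ j₂ → N₂ i j = N i j := fun i j h1 h2 => by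
    rw [hN₂, Matrix.updateCol_ne h2, hN₁_of_ne i j h1]
  have hN₂_j₁ : ∀ i, N₂ i j₁ = N i j₁ - N i j₀ := fun i => by
    rw [hN₂, Matrix.updateCol_ne hj₁₂.symm, hN₁, Matrix.updateCol_self, smul_eq_mul]; ring
  have hN₂_j₂ : ∀ i, N₂ i j₂ = N i j₂ - N i j₀' := fun i => by
    rw [hN₂, Matrix.updateCol_self, hN₁_of_ne i j₂ hj₁₂, hN₁_of_ne i j₀' hj₀', smul_eq_mul]; ring
  -- block form
  obtain ⟨er, her0, her1, herk⟩ := exists_equivPairCompl v₁ v₂''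
  obtain ⟨ec, hec0, hec1, heck⟩ := exists_equivPairCompl j₁ j₂''
  set δ₁₁ : ℂ := (if Q₁ j₁ then (1 : ℂ) else 0) - (if Q₁ j₀ then 1 else 0) with hδ₁₁
  set δ₁₂ : ℂ := (if Q₁ j₂ then (1 : ℂ) else 0) - (if Q₁ j₀' then 1 else 0) with hδ₁₂
  set δ₂₁ : ℂ := (if Q₂ j₁ then (1 : ℂ) else 0) - (if Q₂ j₀ then 1 else 0) with hδ₂₁
  set δ₂₂ : ℂ := (if Q₂ j₂ then (1 : ℂ) else 0) - (if Q₂ j₀' then 1 else 0) with hδ₂₂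
  set K : Matrix (Fin 2) (Fin 2) ℂ :=
    !![s₁ * δ₁₁ * F i₀ j₀, s₁ * δ₁₂ * F i₀ j₀'; s₂ * δ₂₁ * F i₀ j₀, s₂ * δ₂₂ * F i₀ j₀'] with hK
  set S : Matrix (Fin 2) (Fin n) ℂ := Matrix.of fun x k => N₂ (er (Sum.inl x)) (ec (Sum.inr k)) with hS
  set R : Matrix (Fin n) (Fin n) ℂ := F.submatrix (fun k => v₁.succAbove (v₂''.succAbove k))
    (fun k => j₁.succAbove (j₂''.succAbove k)) with hR
  have hrow_ne₁ : ∀ k : Fin n, v₁.succAbove (v₂''.succAbove k) ≠ v₁ := fun k => Fin.succAbove_ne v₁ _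
  have hrow_ne₂ : ∀ k : Fin n, v₁.succAbove (v₂''.succAbove k) ≠ v₂ := fun k e =>
    Fin.succAbove_ne v₂'' k (Fin.succAbove_right_injective e)
  have hcol_ne₁ : ∀ k : Fin n, j₁.succAbove (j₂''.succAbove k) ≠ j₁ := fun k => Fin.succAbove_ne j₁ _
  have hcol_ne₂ : ∀ k : Fin n, j₁.succAbove (j₂''.succAbove k) ≠ j₂ := fun k e =>
    Fin.succAbove_ne j₂'' k (Fin.succAbove_right_injective e)
  have hblock : N₂.submatrix er ec = Matrix.fromBlocks K S 0 R := by
    ext x y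
    rcases x with x | k <;> rcases y with y | l
    · -- the `2 × 2` corner
      rw [Matrix.submatrix_apply, Matrix.fromBlocks_apply₁₁]
      have two : ∀ z : Fin 2, z = 0 ∨ z = 1 := fun z => by
        rcases Fin.eq_zero_or_eq_succ z with hz | ⟨z', hz⟩
        · exact Or.inl hz
        · right; rw [hz, Fin.eq_zero z', Fin.succ_zero_eq_one]
      rcases two x with rfl | rfl <;> rcases two y with rfl | rfl
      · rw [her0, hec0, hN₂_j₁, hNv₁, hNv₁, hcol₁ i₀, hK, hδ₁₁]
        simp only [Matrix.of_apply, Matrix.cons_val', Matrix.cons_val_zero, Matrix.cons_val_fin_one]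
        ring
      · rw [her0, hec1, ← hj₂, hN₂_j₂, hNv₁, hNv₁, hcol₂ i₀, hK, hδ₁₂]
        simp only [Matrix.of_apply, Matrix.cons_val', Matrix.cons_val_zero, Matrix.cons_val_one,
          Matrix.cons_val_fin_one]
        ring
      · rw [her1, ← hv₂, hec0, hN₂_j₁, hNv₂, hNv₂, hcol₁ i₀, hK, hδ₂₁]
        simp only [Matrix.of_apply, Matrix.cons_val', Matrix.cons_val_zero, Matrix.cons_val_one,
          Matrix.cons_val_fin_one]
        ring
      · rw [her1, ← hv₂, hec1, ← hj₂, hN₂_j₂, hNv₂, hNv₂, hcol₂ i₀, hK, hδ₂₂]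
        simp only [Matrix.of_apply, Matrix.cons_val', Matrix.cons_val_one, Matrix.cons_val_fin_one]
        ring
    · rw [Matrix.submatrix_apply, Matrix.fromBlocks_apply₁₂, hS, Matrix.of_apply]
    · -- below the corner: zero
      rw [Matrix.submatrix_apply, Matrix.fromBlocks_apply₂₁, Matrix.zero_apply, herk]
      have two : y = 0 ∨ y = 1 := by
        rcases Fin.eq_zero_or_eq_succ y with hz | ⟨z', hz⟩
        · exact Or.inl hz
        · right; rw [hz, Fin.eq_zero z', Fin.succ_zero_eq_one]
      rcases two with rfl | rfl
      · rw [hec0, hN₂_j₁, hNrest _ _ (hrow_ne₁ k) (hrow_ne₂ k), hNrest _ _ (hrow_ne₁ k) (hrow_ne₂ k),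
          hcol₁, sub_self]
      · rw [hec1, ← hj₂, hN₂_j₂, hNrest _ _ (hrow_ne₁ k) (hrow_ne₂ k),
          hNrest _ _ (hrow_ne₁ k) (hrow_ne₂ k), hcol₂, sub_self]
    · rw [Matrix.submatrix_apply, Matrix.fromBlocks_apply₂₂, herk, heck, hR, Matrix.submatrix_apply,
        hN₂_of_ne _ _ (hcol_ne₁ l) (hcol_ne₂ l), hNrest _ _ (hrow_ne₁ k) (hrow_ne₂ k)]
  have hK : K.det = s₁ * s₂ * (F i₀ j₀ * F i₀ j₀') * (δ₁₁ * δ₂₂ - δ₁₂ * δ₂₁) := by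
    rw [hK, Matrix.det_fin_two_of]; ring
  have hKne : K.det ≠ 0 := by
    rw [hK]
    exact mul_ne_zero (mul_ne_zero (mul_ne_zero hs₁ hs₂) (mul_ne_zero hent₁ hent₂)) (sub_ne_zero.mpr hδ)
  have hsub : (N₂.submatrix er ec).det ≠ 0 := by
    rw [hblock, Matrix.det_fromBlocks_zero₂₁]
    exact mul_ne_zero hKne hminor
  have hN₂ne : N₂.det ≠ 0 := by
    intro hA
    apply hsub
    have e : N₂.submatrix er ec = (N₂.submatrix id (er.symm.trans ec)).submatrix er er := by
      ext x y; simp [Matrix.submatrix_apply]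
    rw [e, Matrix.det_submatrix_equiv_self, Matrix.det_permute', hA, mul_zero]
  rwa [hdet₂, hdet₁] at hN₂ne

/-! ## 3. The two-fold deformation over `ℂ[X]` -/

/-- **Two row edges ⇒ a factor `(X − 1)²`.**  For the deformation
`P i j = F i j · X^{[P₁ i ∧ Q₁ j]} · X^{[P₂ i ∧ Q₂ j]}` of a matrix `F` whose rows `i₀, v₁, v₂` coincide,
where `v₁` differs from `i₀` exactly in the status `P₁` and `v₂` exactly in `P₂`:
`det P = (X − 1)² · det(P with rows v₁, v₂ replaced by the masked rows)`. -/
theorem det_doubleEdgeMatrix_eq {n : ℕ} (F : Matrix (Fin (n + 2)) (Fin (n + 2)) ℂ)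
    (P₁ P₂ Q₁ Q₂ : Fin (n + 2) → Prop) [DecidablePred P₁] [DecidablePred P₂] [DecidablePred Q₁]
    [DecidablePred Q₂] (i₀ v₁ v₂ : Fin (n + 2)) (hi₁ : v₁ ≠ i₀) (hi₂ : v₂ ≠ i₀) (h12 : v₂ ≠ v₁)
    (hP₁v₁ : P₁ v₁ ↔ ¬ P₁ i₀) (hP₂v₁ : P₂ v₁ ↔ P₂ i₀) (hP₁v₂ : P₁ v₂ ↔ P₁ i₀)
    (hP₂v₂ : P₂ v₂ ↔ ¬ P₂ i₀) (hrow₁ : ∀ j, F v₁ j = F i₀ j) (hrow₂ : ∀ j, F v₂ j = F i₀ j) :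
    (Matrix.of fun i j => Polynomial.C (F i j) *
        ((if P₁ i ∧ Q₁ j then (Polynomial.X : Polynomial ℂ) else 1) *
          (if P₂ i ∧ Q₂ j then (Polynomial.X : Polynomial ℂ) else 1))).det =
      (Polynomial.X - 1) ^ 2 *
        (((Matrix.of fun i j => Polynomial.C (F i j) *
            ((if P₁ i ∧ Q₁ j then (Polynomial.X : Polynomial ℂ) else 1) *
              (if P₂ i ∧ Q₂ j then (Polynomial.X : Polynomial ℂ) else 1))).updateRow v₁
            (fun j => (if Q₁ j then (1 : Polynomial ℂ) else 0) * ((if P₁ v₁ then (1 : Polynomial ℂ) else -1) *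
              (Polynomial.C (F i₀ j) * (if P₂ i₀ ∧ Q₂ j then (Polynomial.X : Polynomial ℂ) else 1))))
          ).updateRow v₂
            (fun j => (if Q₂ j then (1 : Polynomial ℂ) else 0) * ((if P₂ v₂ then (1 : Polynomial ℂ) else -1) *
              (Polynomial.C (F i₀ j) * (if P₁ i₀ ∧ Q₁ j then (Polynomial.X : Polynomial ℂ) else 1))))
          ).det := by
  classical
  set P : Matrix (Fin (n + 2)) (Fin (n + 2)) (Polynomial ℂ) := Matrix.of fun i j =>
    Polynomial.C (F i j) * ((if P₁ i ∧ Q₁ j then (Polynomial.X : Polynomial ℂ) else 1) *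
      (if P₂ i ∧ Q₂ j then (Polynomial.X : Polynomial ℂ) else 1)) with hP
  set ρ₁ : Fin (n + 2) → Polynomial ℂ := fun j =>
    (if Q₁ j then (1 : Polynomial ℂ) else 0) * ((if P₁ v₁ then (1 : Polynomial ℂ) else -1) *
      (Polynomial.C (F i₀ j) * (if P₂ i₀ ∧ Q₂ j then (Polynomial.X : Polynomial ℂ) else 1))) with hρ₁
  set ρ₂ : Fin (n + 2) → Polynomial ℂ := fun j =>
    (if Q₂ j then (1 : Polynomial ℂ) else 0) * ((if P₂ v₂ then (1 : Polynomial ℂ) else -1) *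
      (Polynomial.C (F i₀ j) * (if P₁ i₀ ∧ Q₁ j then (Polynomial.X : Polynomial ℂ) else 1))) with hρ₂
  -- first row operation
  have hop₁ := Matrix.det_updateRow_add_smul_self P hi₁ (-1)
  have hrow₁' : P v₁ + (-1 : Polynomial ℂ) • P i₀ = ((Polynomial.X : Polynomial ℂ) - 1) • ρ₁ := by
    ext j
    simp only [Pi.add_apply, Pi.smul_apply, smul_eq_mul, hP, Matrix.of_apply, hrow₁ j, hρ₁]
    have e2 : (if P₂ v₁ ∧ Q₂ j then (Polynomial.X : Polynomial ℂ) else 1) =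
        (if P₂ i₀ ∧ Q₂ j then (Polynomial.X : Polynomial ℂ) else 1) := by
      simp only [hP₂v₁]
    rw [e2]
    by_cases hq : Q₁ j
    · by_cases hp : P₁ v₁
      · have hp0 : ¬ P₁ i₀ := hP₁v₁.mp hp
        simp only [hq, hp, hp0, and_true, if_true, if_false]
        ring
      · have hp0 : P₁ i₀ := by by_contra h0; exact hp (hP₁v₁.mpr h0)
        simp only [hq, hp, hp0, and_true, if_true, if_false]
        ring
    · simp only [hq, and_false, if_false]
      ring
  rw [hrow₁', Matrix.det_updateRow_smul] at hop₁
  -- second row operation, on the updated matrix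
  set P' := P.updateRow v₁ ρ₁ with hP'
  have hi₀' : P' i₀ = P i₀ := by
    ext j; rw [hP', Matrix.updateRow_ne hi₁.symm]
  have hv₂' : P' v₂ = P v₂ := by
    ext j; rw [hP', Matrix.updateRow_ne h12]
  have hop₂ := Matrix.det_updateRow_add_smul_self P' hi₂ (-1)
  have hrow₂' : P' v₂ + (-1 : Polynomial ℂ) • P' i₀ = ((Polynomial.X : Polynomial ℂ) - 1) • ρ₂ := by
    rw [hi₀', hv₂']
    ext j
    simp only [Pi.add_apply, Pi.smul_apply, smul_eq_mul, hP, Matrix.of_apply, hrow₂ j, hρ₂]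
    have e1 : (if P₁ v₂ ∧ Q₁ j then (Polynomial.X : Polynomial ℂ) else 1) =
        (if P₁ i₀ ∧ Q₁ j then (Polynomial.X : Polynomial ℂ) else 1) := by
      simp only [hP₁v₂]
    rw [e1]
    by_cases hq : Q₂ j
    · by_cases hp : P₂ v₂
      · have hp0 : ¬ P₂ i₀ := hP₂v₂.mp hp
        simp only [hq, hp, hp0, and_true, if_true, if_false]
        ring
      · have hp0 : P₂ i₀ := by by_contra h0; exact hp (hP₂v₂.mpr h0)
        simp only [hq, hp, hp0, and_true, if_true, if_false]
        ring
    · simp only [hq, and_false, if_false]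
      ring
  rw [hrow₂', Matrix.det_updateRow_smul] at hop₂
  -- assemble
  rw [← hop₁, ← hop₂]
  ring

/-- **Double edge against double edge: some parameter works.** -/
theorem exists_det_doubleEdge_ne_zero {n : ℕ} (F : Matrix (Fin (n + 2)) (Fin (n + 2)) ℂ)
    (P₁ P₂ Q₁ Q₂ : Fin (n + 2) → Prop) [DecidablePred P₁] [DecidablePred P₂] [DecidablePred Q₁]
    [DecidablePred Q₂] (i₀ v₁ : Fin (n + 2)) (v₂'' : Fin (n + 1))
    (j₀ j₀' j₁ : Fin (n + 2)) (j₂'' : Fin (n + 1))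
    (hi₁ : v₁ ≠ i₀) (hi₂ : v₁.succAbove v₂'' ≠ i₀)
    (hP₁v₁ : P₁ v₁ ↔ ¬ P₁ i₀) (hP₂v₁ : P₂ v₁ ↔ P₂ i₀)
    (hP₁v₂ : P₁ (v₁.succAbove v₂'') ↔ P₁ i₀) (hP₂v₂ : P₂ (v₁.succAbove v₂'') ↔ ¬ P₂ i₀)
    (hrow₁ : ∀ j, F v₁ j = F i₀ j) (hrow₂ : ∀ j, F (v₁.succAbove v₂'') j = F i₀ j)
    (hj₀ : j₀ ≠ j₁) (hj₀' : j₀' ≠ j₁) (hj₀'₂ : j₀' ≠ j₁.succAbove j₂'')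
    (hcol₁ : ∀ i, F i j₁ = F i j₀) (hcol₂ : ∀ i, F i (j₁.succAbove j₂'') = F i j₀')
    (hδ : ((if Q₁ j₁ then (1 : ℂ) else 0) - (if Q₁ j₀ then 1 else 0)) *
        ((if Q₂ (j₁.succAbove j₂'') then (1 : ℂ) else 0) - (if Q₂ j₀' then 1 else 0)) ≠
      ((if Q₁ (j₁.succAbove j₂'') then (1 : ℂ) else 0) - (if Q₁ j₀' then 1 else 0)) *
        ((if Q₂ j₁ then (1 : ℂ) else 0) - (if Q₂ j₀ then 1 else 0)))
    (hent₁ : F i₀ j₀ ≠ 0) (hent₂ : F i₀ j₀' ≠ 0)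
    (hminor : (F.submatrix (fun k => v₁.succAbove (v₂''.succAbove k))
      (fun k => j₁.succAbove (j₂''.succAbove k))).det ≠ 0) :
    ∃ t : ℂ, (Matrix.of fun i j => (if P₁ i ∧ Q₁ j then t else 1) *
      ((if P₂ i ∧ Q₂ j then t else 1) * F i j)).det ≠ 0 := by
  classical
  set v₂ := v₁.succAbove v₂'' with hv₂
  have h12 : v₂ ≠ v₁ := Fin.succAbove_ne v₁ v₂''
  set P : Matrix (Fin (n + 2)) (Fin (n + 2)) (Polynomial ℂ) := Matrix.of fun i j =>
    Polynomial.C (F i j) * ((if P₁ i ∧ Q₁ j then (Polynomial.X : Polynomial ℂ) else 1) *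
      (if P₂ i ∧ Q₂ j then (Polynomial.X : Polynomial ℂ) else 1)) with hP
  set R₂ : Matrix (Fin (n + 2)) (Fin (n + 2)) (Polynomial ℂ) :=
    ((P.updateRow v₁
        (fun j => (if Q₁ j then (1 : Polynomial ℂ) else 0) * ((if P₁ v₁ then (1 : Polynomial ℂ) else -1) *
          (Polynomial.C (F i₀ j) * (if P₂ i₀ ∧ Q₂ j then (Polynomial.X : Polynomial ℂ) else 1))))
      ).updateRow v₂
        (fun j => (if Q₂ j then (1 : Polynomial ℂ) else 0) * ((if P₂ v₂ then (1 : Polynomial ℂ) else -1) *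
          (Polynomial.C (F i₀ j) * (if P₁ i₀ ∧ Q₁ j then (Polynomial.X : Polynomial ℂ) else 1)))))
    with hR₂
  set D : Polynomial ℂ := R₂.det with hD
  have hfac : P.det = (Polynomial.X - 1) ^ 2 * D :=
    det_doubleEdgeMatrix_eq F P₁ P₂ Q₁ Q₂ i₀ v₁ v₂ hi₁ hi₂ h12 hP₁v₁ hP₂v₁ hP₁v₂ hP₂v₂ hrow₁ hrow₂
  -- evaluation of the deformation at `t`
  have heval : ∀ t : ℂ, (Polynomial.evalRingHom t).mapMatrix P =
      Matrix.of fun i j => (if P₁ i ∧ Q₁ j then t else 1) * ((if P₂ i ∧ Q₂ j then t else 1) * F i j) := by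
    intro t
    ext i j
    simp only [RingHom.mapMatrix_apply, Matrix.map_apply, hP, Matrix.of_apply,
      Polynomial.coe_evalRingHom, Polynomial.eval_mul, Polynomial.eval_C]
    split_ifs <;> simp [mul_comm, mul_left_comm]
  -- `D(1) ≠ 0`
  set s₁ : ℂ := if P₁ v₁ then (1 : ℂ) else -1 with hs₁
  set s₂ : ℂ := if P₂ v₂ then (1 : ℂ) else -1 with hs₂
  have hs₁ne : s₁ ≠ 0 := by rw [hs₁]; split_ifs <;> norm_num
  have hs₂ne : s₂ ≠ 0 := by rw [hs₂]; split_ifs <;> norm_num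
  have hD1 : Polynomial.eval 1 D ≠ 0 := by
    have e : (Polynomial.evalRingHom (1 : ℂ)).mapMatrix R₂ =
        (F.updateRow v₁ (fun j => (if Q₁ j then (1 : ℂ) else 0) * (s₁ * F i₀ j))).updateRow v₂
          (fun j => (if Q₂ j then (1 : ℂ) else 0) * (s₂ * F i₀ j)) := by
      ext i j
      by_cases hi : i = v₂
      · subst hi
        simp only [RingHom.mapMatrix_apply, Matrix.map_apply, hR₂, Matrix.updateRow_self,
          Polynomial.coe_evalRingHom, hs₂]
        split_ifs <;> simp
      · by_cases hi' : i = v₁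
        · subst hi'
          simp only [RingHom.mapMatrix_apply, Matrix.map_apply, hR₂, Matrix.updateRow_ne hi,
            Matrix.updateRow_self, Polynomial.coe_evalRingHom, hs₁]
          split_ifs <;> simp
        · simp only [RingHom.mapMatrix_apply, Matrix.map_apply, hR₂, Matrix.updateRow_ne hi,
            Matrix.updateRow_ne hi', hP, Matrix.of_apply, Polynomial.coe_evalRingHom,
            Polynomial.eval_mul, Polynomial.eval_C]
          split_ifs <;> simp
    have e2 : Polynomial.eval 1 D =
        ((F.updateRow v₁ (fun j => (if Q₁ j then (1 : ℂ) else 0) * (s₁ * F i₀ j))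
          ).updateRow v₂ (fun j => (if Q₂ j then (1 : ℂ) else 0) * (s₂ * F i₀ j))).det := by
      rw [hD, ← Polynomial.coe_evalRingHom, RingHom.map_det, e]
    rw [e2]
    exact det_doubleMasked_ne_zero F Q₁ Q₂ s₁ s₂ hs₁ne hs₂ne i₀ v₁ v₂'' j₀ j₀' j₁ j₂'' hj₀ hj₀' hj₀'₂
      hcol₁ hcol₂ hδ hent₁ hent₂ hminor
  have hD0 : D ≠ 0 := fun h0 => hD1 (by rw [h0, Polynomial.eval_zero])
  obtain ⟨t, ht⟩ := Infinite.exists_notMem_finset (insert (1 : ℂ) D.roots.toFinset)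
  rw [Finset.mem_insert, not_or, Multiset.mem_toFinset, Polynomial.mem_roots hD0] at ht
  refine ⟨t, ?_⟩
  rw [← heval t, ← RingHom.map_det, hfac, Polynomial.coe_evalRingHom, Polynomial.eval_mul,
    Polynomial.eval_pow, Polynomial.eval_sub, Polynomial.eval_X, Polynomial.eval_one]
  exact mul_ne_zero (pow_ne_zero _ (sub_ne_zero.mpr ht.1)) ht.2

end

end Summit.ValiantsHypothesis.ValiantsHypothesis.Theorems.BarrierLever.ChowFactor
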